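import Summits.BirchSwinnertonDyer.BirchSwinnertonDyer.Theorems.ThetaPartnerAtTwoSignedKatoUpToAtTwoLayerPairingModDefs
import Summits.BirchSwinnertonDyer.BirchSwinnertonDyer.Theorems.ResidualThetaTransportAtTwoRlfTwistLayerRes
import Literature.NumberTheory.GaloisRepresentations.ContinuousShapiroLiftCores
import Literature.NumberTheory.GaloisRepresentations.ContinuousShapiroLiftPairing
import HarnessLib

/-!
# Route `ResidualThetaTransportAtTwo` (RTT P6, item stmt-BirchSwinnertonDyer-23110, road T), ISO θ-plan, LAYER DICTIONARY
# bricks (D5)–(D7): the layer cup products `inv_v(Sh_n x ∪_{Σe} Sh_n y)` of ARBITRARY classes are compatible with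
# corestriction/restriction across layers (projection formula) and with the conjugation action, and
# `coresLe` / `resLe` / `conj_g` / `layerKummer` carry `A`-witnesses to `A`-witnesses

Lead seat `bsd-wall-tp2-p2x` g13 (cell `bsd-wall`), line `hplusdual` on 23110 (stub `stub_iso` ⟸ B4
`TwistedLocalKummer.iso_of_corSurj_of_layerIso` ⟸ COR-SURJ + LAYER-ISO; LAYER-ISO ⟸ θ-plan). THEOREMS ONLY (no definition, no
named fact, no instance, no `sorry`); closes nothing; 23110 is NOT proved; BSD is NOT proved by any of this.

The θ-plan (B. D. Kim, Compositio 143 (2007), proof of Prop. 3.15, pp. 56–57, read at `p = 2`) extracts from the family of layer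
pairings `B_n(s, t) = inv_v(Sh_n c_n(s) ∪_{Σe} Sh_n c_n(t))` on the layers `S[2^J, ω_n]` of a realization `S` of `A ⊗ ℚ₂/ℤ₂`
(`A = ⋃ₙ E⁺(ℚ_{v,n})`, `c_n(s)` = the `U_n`-class with `A`-witness attached to `s`) the elements `θ_n ∈ Λ/(2^J, ω_n)` and kills them
by Weierstrass preparation (`PlusDual.forall_mem_omegaIdeal_of_compatible`). Its two structural inputs on the COHOMOLOGY side are
proved here for ARBITRARY classes `x ∈ H¹(U_{n+1}, E[N]|)`, `y ∈ H¹(U_n, E[N]|)` (the K3 currency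
`LayerPairing.layerShapiro / layerSumPairing / invAt` of `…SignedKatoUpToAtTwoLayerPairingModDefs`, whose `layerPairingMod_layerCores` /
`layerPairingMod_conjMap` are the special case `y = layerKummer`):

* §1 (D5, pairing) `invAt_cupProduct_layerShapiro_coresLe` — **(P1′) the projection formula across layers**:
  `inv_v(Sh_n (cor_{n+1→n} x) ∪ Sh_n y) = inv_v(Sh_{n+1} x ∪ Sh_{n+1} (res_{n→n+1} y))`.
* §2 (D6, pairing) `invAt_cupProduct_layerShapiro_layerConj` — **(P2′) Galois invariance**:
  `inv_v(Sh_n (g·x) ∪ Sh_n (g·y)) = inv_v(Sh_n x ∪ Sh_n y)` for `g ∈ Γ_{ℚ_v}`.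
* §3 (D5/D6/D7, witnesses) — an `A`-WITNESS of a `U_n`-cocycle `f` is a point `Q ∈ E(ℚ̄_v)` with `f(τ) = τQ − Q` on points for
  `τ ∈ N = Gal(ℚ̄_v/ℚ_{v,∞})` (and `2^k Q ∈ A`); then: `res_{n→n+1} f` has the witness `Q` (`pointsMap_resLe_pullback_apply`);
  the relative transfer `cor_{n+1→n} f` has the witness `Σ_x s(x)•Q` (`pointsMap_relTransferCocycle_apply_of_layerWitness`, the
  untwisted RELATIVE twin of w2's `TwistedLocalKummer.pointsMap_transferCocycle_apply_of_layerWitness`); the conjugate `g·f` has the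
  witness `g•Q` (`pointsMap_conj_pullback_apply_of_layerWitness`); and the layer Kummer class `κ_{U_n}(P)` of a point
  `P ∈ E(ℚ_{n,v})` has the witness `Q = ` any `N`-th root of `P` (`layerKummer_eq_oneCocycleClass_of_root`,
  `pointsMap_subgroupKummerCocycle_apply_of_mem`).

References: B. D. Kim, Compositio Math. 143 (2007), Prop. 3.15 (proof) [BDKim2007]; J. Neukirch, A. Schmidt, K. Wingberg,
*Cohomology of Number Fields* (2008), I §5 (1.5.3)(iv), (1.5.6)–(1.5.7), I §6 (1.6.4) [NeukirchSchmidtWingberg2008]; J.-P. Serre,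
*Local Fields* (1979), VII §5 [SerreLocalFields1979]; S. Kobayashi, Invent. math. 152 (2003), (8.23) [Kobayashi2003].
-/

set_option autoImplicit false
-- the Theorems namespace of this sub repeats the summit name by design (D-0017 nested layout)
set_option linter.dupNamespace false

noncomputable section

open scoped Classical NumberField
open CategoryTheory Field NumberField IsDedekindDomain WeierstrassCurve

namespace Summit.BirchSwinnertonDyer.BirchSwinnertonDyer.Theorems.SignedEC.LayerClassPairing

open Literature.NumberTheory.EllipticCurves Literature.NumberTheory.GaloisRepresentations
  Literature.NumberTheory.EllipticCurves.Kobayashi2003 Literature.NumberTheory.GaloisCohomology ZpExtension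
  SignedKatoOffTwo SignedKatoOffTwo.LayerPairing

-- Cup products need `LocallyCompactSpace Γ_{ℚ_v}`: supplied as the binder `[CompactSpace Γ_{ℚ_v}]` (= `absoluteGaloisGroup_compactSpace _`
-- at the call site), as in `TwistedLocalKummer.iso_of_corSurj_of_layerIso`; no local instances in this file.

variable (W : WeierstrassCurve ℚ) [W.IsElliptic] (N : ℕ) [NeZero N]
  (e : geomTorsion W N → geomTorsion W N → AlgebraicClosure ℚ)
  (hμ : ∀ S T, e S T ^ N = 1)
  (hadd₁ : ∀ S₁ S₂ T, e (S₁ + S₂) T = e S₁ T * e S₂ T)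
  (hadd₂ : ∀ S T₁ T₂, e S (T₁ + T₂) = e S T₁ * e S T₂)
  (hgal : ∀ (σ : absoluteGaloisGroup ℚ) (S T : geomTorsion W N), σ • e S T = e (σ • S) (σ • T))
  {p : ℕ} [Fact p.Prime] (κ : ZpExtension ℚ p) (v : HeightOneSpectrum (𝓞 ℚ))

/-! ## §1 (D5) The projection formula across layers, for arbitrary classes -/

omit [W.IsElliptic] in
/-- **(P1′) for arbitrary classes — the projection formula across the layers `U_{n+1} ≤ U_n`.** For
`x ∈ H¹(U_{n+1}, E[N]|)` and `y ∈ H¹(U_n, E[N]|)`,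
`inv_v(Sh_n (cor_{U_{n+1}→U_n} x) ∪_{Σe} Sh_n y) = inv_v(Sh_{n+1} x ∪_{Σe} Sh_{n+1} (res_{U_n→U_{n+1}} y))`.
Shapiro carries the relative corestriction to the fibre sum (`cohomologyMap_coindFinSum_shapiroLift`), the fibre sum in the
first slot is adjoint to the pull-back in the second (`cupProduct_coindFinSum_left`), and Shapiro carries the pull-back to
restriction (`cohomologyMap_coindFinRes_shapiroLift`) — the chain of `LayerPairing.layerPairingMod_layerCores` for a general
second argument. [cite: NeukirchSchmidtWingberg2008, I §5 Prop. (1.5.3)(iv), I §6 Prop. (1.6.4)] [cite: BDKim2007, Prop. 3.15 (proof)] -/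
theorem invAt_cupProduct_layerShapiro_coresLe [CompactSpace (absoluteGaloisGroup (v.adicCompletion ℚ))] (n : ℕ)
    [Fintype (layerGroup κ v n ⧸ (layerGroup κ v (n + 1)).subgroupOf (layerGroup κ v n))]
    (x : continuousCohomology 1 (subgroupRep (torsionLocalRep W N v) (layerGroup κ v (n + 1))))
    (y : continuousCohomology 1 (subgroupRep (torsionLocalRep W N v) (layerGroup κ v n))) :
    invAt N v ((layerSumPairing W N e hμ hadd₁ hadd₂ hgal κ v n).cupProduct
        (layerShapiro W N κ v n
          (coresLe (torsionLocalRep W N v) (layerGroup_antitone κ v n) (isOpen_layerGroup κ v (n + 1)) x))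
        (layerShapiro W N κ v n y)) =
      invAt N v ((layerSumPairing W N e hμ hadd₁ hadd₂ hgal κ v (n + 1)).cupProduct
        (layerShapiro W N κ v (n + 1) x)
        (layerShapiro W N κ v (n + 1) (resLe (torsionLocalRep W N v) (layerGroup_antitone κ v n) 1 y))) := by
  letI : Fintype (absoluteGaloisGroup (v.adicCompletion ℚ) ⧸ layerGroup κ v n) := layerFintypeQuot κ v n
  letI : Fintype (absoluteGaloisGroup (v.adicCompletion ℚ) ⧸ layerGroup κ v (n + 1)) := layerFintypeQuot κ v (n + 1)
  unfold layerShapiro layerSumPairing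
  rw [← cohomologyMap_coindFinSum_shapiroLift (torsionLocalRep W N v) (layerGroup_antitone κ v n) (isOpen_layerGroup κ v n)
      (isOpen_layerGroup κ v (n + 1)) (layerReps_spec κ v n) (layerReps_one κ v n) (layerReps_spec κ v (n + 1))
      (layerReps_one κ v (n + 1)),
    ← cohomologyMap_id_muLocalRep N v (ContPairing.cupProduct _ _ _),
    ContPairing.cupProduct_coindFinSum_left,
    cohomologyMap_coindFinRes_shapiroLift (torsionLocalRep W N v) (layerGroup_antitone κ v n) (isOpen_layerGroup κ v n)
      (isOpen_layerGroup κ v (n + 1)) (layerReps_spec κ v n) (layerReps_one κ v n) (layerReps_spec κ v (n + 1))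
      (layerReps_one κ v (n + 1))]

/-! ## §2 (D6) Galois invariance of the layer cup products, for arbitrary classes -/

omit [W.IsElliptic] in
/-- **(P2′) for arbitrary classes — invariance under the conjugation action.** For `g ∈ Γ_{ℚ_v}` and
`x, y ∈ H¹(U_n, E[N]|)`, `inv_v(Sh_n (g·x) ∪_{Σe} Sh_n (g·y)) = inv_v(Sh_n x ∪_{Σe} Sh_n y)`: Shapiro turns the conjugation
into the right translation by `gU_n` (`shapiroLift_conjMap`) and the summed pairing is invariant under right translations
(`cupProduct_rTransHom`). [cite: SerreLocalFields1979, VII §5] [cite: BDKim2007, Prop. 3.15 (proof)] -/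
theorem invAt_cupProduct_layerShapiro_layerConj [CompactSpace (absoluteGaloisGroup (v.adicCompletion ℚ))] (n : ℕ) (g : absoluteGaloisGroup (v.adicCompletion ℚ))
    (x y : continuousCohomology 1 (subgroupRep (torsionLocalRep W N v) (layerGroup κ v n))) :
    invAt N v ((layerSumPairing W N e hμ hadd₁ hadd₂ hgal κ v n).cupProduct
        (layerShapiro W N κ v n (layerConj W N κ v n g x)) (layerShapiro W N κ v n (layerConj W N κ v n g y))) =
      invAt N v ((layerSumPairing W N e hμ hadd₁ hadd₂ hgal κ v n).cupProduct
        (layerShapiro W N κ v n x) (layerShapiro W N κ v n y)) := by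
  haveI := normal_layerGroup κ v n
  letI : Fintype (absoluteGaloisGroup (v.adicCompletion ℚ) ⧸ layerGroup κ v n) := layerFintypeQuot κ v n
  unfold layerShapiro layerSumPairing layerConj
  rw [shapiroLift_conjMap, shapiroLift_conjMap, ContPairing.cupProduct_rTransHom, cohomologyMap_id_muLocalRep]

/-! ## §3 Witnesses under restriction, relative corestriction and conjugation — GENERIC `K`-field `E`

The three computations are done once for an arbitrary `K`-field `E` (subgroups `U' ≤ U ≤ Γ_E`, a normal subgroup `N₀ ≤ U'` on which
the witnesses live); §4 reads them at `E = ℚ_v`, `U = U_n`, `U' = U_{n+1}`, `N₀ = Gal(ℚ̄_v/ℚ_{v,∞})` by instantiation. -/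

section Generic

universe u

variable {K : Type u} [Field K] (V : WeierstrassCurve K) (n₀ : ℤ)
  {E : Type u} [Field E] [Algebra K E]

/-- `σ ∈ Γ_E` acts on `E[n]|` by `res σ`, read on the points of `E(K̄_E)`: `pointsMap (σ·m) = σ • pointsMap m`. [cite: SilvermanAEC2009, X §4] -/
theorem pointsMap_toTopRep_ρ_apply (σ : absoluteGaloisGroup E) (m : geomTorsion V n₀) :
    pointsMap V E (((DiscreteGaloisModule.toTopRep (GaloisRep.restrictField E (V.torsionGaloisModule n₀))).ρ σ m :
        geomTorsion V n₀) : geomPoints V) =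
      σ • pointsMap V E (m : geomPoints V) := by
  change pointsMap V E ((V.torsionGaloisModule n₀ (resGal (K := K) E σ) m : geomTorsion V n₀) : geomPoints V) = _
  rw [torsionGaloisModule_apply_apply, Literature.NumberTheory.EllipticCurves.AddSubgroup.torsionBy.coe_smul, pointsMap_smul]

/-- **Restriction keeps the values** (hence every witness): for `U' ≤ U ≤ Γ_E`, the restriction to `U'` of a `U`-cocycle `f` of
`E[n]|` is represented by `τ ↦ f(τ)`. [cite: NeukirchSchmidtWingberg2008, I §5] -/
theorem exists_resLe_cocycle_apply_eq_generic {U U' : Subgroup (absoluteGaloisGroup E)} (h : U' ≤ U)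
    (f : contOneCocycles (subgroupRep (DiscreteGaloisModule.toTopRep (GaloisRep.restrictField E (V.torsionGaloisModule n₀))) U)) :
    ∃ f' : contOneCocycles (subgroupRep (DiscreteGaloisModule.toTopRep (GaloisRep.restrictField E (V.torsionGaloisModule n₀))) U'),
      oneCocycleClass _ f' =
        resLe (DiscreteGaloisModule.toTopRep (GaloisRep.restrictField E (V.torsionGaloisModule n₀))) h 1 (oneCocycleClass _ f) ∧
      ∀ τ : U', f'.1 τ = f.1 ⟨τ, h τ.2⟩ := by
  have key := resLe_oneCocycleClass (DiscreteGaloisModule.toTopRep (GaloisRep.restrictField E (V.torsionGaloisModule n₀))) h f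
  refine ⟨_, key.symm, fun τ ↦ ?_⟩
  rw [contOneCocycles.pullback_apply, TopRep.hom_ofHom]
  rfl

/-- **The relative transfer of a witness cocycle has the norm of the witness as witness** (generic `K`-field `E`): for
`N₀ ≤ U' ≤ U ≤ Γ_E` with `N₀ ⊴ Γ_E`, `U' ⊴ Γ_E` open, a `U'`-cocycle `f` of `E[n]|` with `f(τ) = τQ − Q` on points for `τ ∈ N₀`, and
any system `s` of representatives of `U ⧸ U'`, the transfer cocycle `F` (representing `cor_{U'→U}[f]`, `coresLe`) satisfies
`F(τ) = τQ' − Q'` on points for `τ ∈ N₀`, `Q' = Σ_x s(x) • Q`: `N₀ ⊴ Γ_E` fixes every coset, so the Schreier elements of `τ` are the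
conjugates `s(x)⁻¹ τ s(x) ∈ N₀` (the untwisted, relative twin of `TwistedLocalKummer.pointsMap_transferCocycle_apply_of_layerWitness`).
[cite: BDKim2007, Prop. 3.15 (proof)] [cite: NeukirchSchmidtWingberg2008, I §5 (1.5.6)–(1.5.7)] -/
theorem exists_coresLe_cocycle_of_witness_generic {U U' : Subgroup (absoluteGaloisGroup E)} [U'.Normal] (h : U' ≤ U)
    (hU' : IsOpen (U' : Set (absoluteGaloisGroup E))) [Fintype (U ⧸ U'.subgroupOf U)]
    {s : U ⧸ U'.subgroupOf U → U} (hs : ∀ x, (s x : U ⧸ U'.subgroupOf U) = x)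
    (N₀ : Subgroup (absoluteGaloisGroup E)) [N₀.Normal] (hN₀ : N₀ ≤ U')
    (f : contOneCocycles (subgroupRep (DiscreteGaloisModule.toTopRep (GaloisRep.restrictField E (V.torsionGaloisModule n₀))) U'))
    (Q : localPoints V E)
    (hf : ∀ (τ : absoluteGaloisGroup E) (hτ : τ ∈ N₀),
      pointsMap V E ((f.1 ⟨τ, hN₀ hτ⟩ : geomTorsion V n₀) : geomPoints V) = τ • Q - Q) :
    ∃ F : contOneCocycles (subgroupRep (DiscreteGaloisModule.toTopRep (GaloisRep.restrictField E (V.torsionGaloisModule n₀))) U),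
      oneCocycleClass _ F =
        coresLe (DiscreteGaloisModule.toTopRep (GaloisRep.restrictField E (V.torsionGaloisModule n₀))) h hU' (oneCocycleClass _ f) ∧
      ∀ (τ : absoluteGaloisGroup E) (hτ : τ ∈ N₀),
        pointsMap V E ((F.1 ⟨τ, h (hN₀ hτ)⟩ : geomTorsion V n₀) : geomPoints V) =
          τ • (∑ x, ((s x : absoluteGaloisGroup E) • Q)) - ∑ x, ((s x : absoluteGaloisGroup E) • Q) := by
  have key := coresLe_oneCocycleClass (DiscreteGaloisModule.toTopRep (GaloisRep.restrictField E (V.torsionGaloisModule n₀))) h hU' hs f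
  refine ⟨_, key.symm, fun τ hτ ↦ ?_⟩
  set τ' : U := ⟨τ, h (hN₀ hτ)⟩ with hτ'
  have hτ'mem : τ' ∈ U'.subgroupOf U := Subgroup.mem_subgroupOf.mpr (hN₀ hτ)
  have hfix : ∀ x : U ⧸ U'.subgroupOf U, τ' • x = x := fun x ↦ coe_smul_quotient_eq (U'.subgroupOf U) ⟨τ', hτ'mem⟩ x
  have hconj : ∀ x : U ⧸ U'.subgroupOf U, ((s x : absoluteGaloisGroup E))⁻¹ * τ * (s x : absoluteGaloisGroup E) ∈ N₀ := fun x ↦ by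
    have hc := Subgroup.Normal.conj_mem (inferInstance : N₀.Normal) τ hτ ((s x : absoluteGaloisGroup E))⁻¹
    rwa [inv_inv] at hc
  rw [transferCocycle_apply, transferFun_apply, AddSubmonoidClass.coe_finsetSum, map_sum, Finset.smul_sum,
    ← Finset.sum_sub_distrib]
  refine Finset.sum_congr rfl fun x _ ↦ ?_
  rw [hfix, subgroupRep_ρ_apply, pointsMap_toTopRep_ρ_apply, contOneCocycles.pullback_apply, TopRep.hom_ofHom]
  have hval : pointsMap V E ((f.1 (subgroupOfHom h (schreierElt (U'.subgroupOf U) hs τ' x)) : geomTorsion V n₀) : geomPoints V) =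
      (((s x : absoluteGaloisGroup E))⁻¹ * τ * (s x : absoluteGaloisGroup E)) • Q - Q := by
    rw [← hf _ (hconj x)]
    congr 3
    apply Subtype.ext
    change (((schreierElt (U'.subgroupOf U) hs τ' x : U'.subgroupOf U) : U) : absoluteGaloisGroup E) = _
    rw [schreierElt_coe, hfix, Subgroup.coe_mul, Subgroup.coe_mul, Subgroup.coe_inv]
  change (s x : absoluteGaloisGroup E) •
      pointsMap V E ((f.1 (subgroupOfHom h (schreierElt (U'.subgroupOf U) hs τ' x)) : geomTorsion V n₀) : geomPoints V) = _
  rw [hval, smul_sub, mul_smul, mul_smul, smul_inv_smul]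

/-- **The conjugate of a witness cocycle has the translated witness** (generic `K`-field `E`): for `U, N₀ ⊴ Γ_E`, `N₀ ≤ U`,
`g ∈ Γ_E`, and a `U`-cocycle `f` of `E[n]|` with `f(τ) = τQ − Q` on points for `τ ∈ N₀`, the conjugate cocycle `x ↦ g • f(g⁻¹ x g)`
(representing `g·[f]`, `conjMap`) satisfies the same with `g • Q`. [cite: SerreLocalFields1979, VII §5] [cite: Kobayashi2003, (8.23)] -/
theorem exists_conj_cocycle_of_witness_generic (U : Subgroup (absoluteGaloisGroup E)) [U.Normal] (g : absoluteGaloisGroup E)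
    (N₀ : Subgroup (absoluteGaloisGroup E)) [N₀.Normal] (hN₀ : N₀ ≤ U)
    (f : contOneCocycles (subgroupRep (DiscreteGaloisModule.toTopRep (GaloisRep.restrictField E (V.torsionGaloisModule n₀))) U))
    (Q : localPoints V E)
    (hf : ∀ (τ : absoluteGaloisGroup E) (hτ : τ ∈ N₀),
      pointsMap V E ((f.1 ⟨τ, hN₀ hτ⟩ : geomTorsion V n₀) : geomPoints V) = τ • Q - Q) :
    ∃ F : contOneCocycles (subgroupRep (DiscreteGaloisModule.toTopRep (GaloisRep.restrictField E (V.torsionGaloisModule n₀))) U),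
      oneCocycleClass _ F =
        conjMap (DiscreteGaloisModule.toTopRep (GaloisRep.restrictField E (V.torsionGaloisModule n₀))) U g 1 (oneCocycleClass _ f) ∧
      ∀ (τ : absoluteGaloisGroup E) (hτ : τ ∈ N₀),
        pointsMap V E ((F.1 ⟨τ, hN₀ hτ⟩ : geomTorsion V n₀) : geomPoints V) = τ • (g • Q) - g • Q := by
  refine ⟨contOneCocycles.pullback (subgroupConj U g)
      (conjRepHom (DiscreteGaloisModule.toTopRep (GaloisRep.restrictField E (V.torsionGaloisModule n₀))) U g) f,
    (conjMap_oneCocycleClass _ _ g f).symm, fun τ hτ ↦ ?_⟩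
  have hconj : g⁻¹ * τ * g ∈ N₀ := by
    have hc := Subgroup.Normal.conj_mem (inferInstance : N₀.Normal) τ hτ g⁻¹
    rwa [inv_inv] at hc
  rw [conj_pullback_apply, pointsMap_toTopRep_ρ_apply]
  have hval : pointsMap V E ((f.1 (subgroupConj U g ⟨τ, hN₀ hτ⟩) : geomTorsion V n₀) : geomPoints V) = (g⁻¹ * τ * g) • Q - Q := by
    rw [← hf _ hconj]
    congr 3
  rw [hval, smul_sub, mul_smul, mul_smul, smul_inv_smul]

end Generic

/-! ## §4 (D5)/(D6)/(D7) at `E = ℚ_v`: `U = U_n`, `U' = U_{n+1}`, witnesses on `N = Gal(ℚ̄_v/ℚ_{v,∞})` -/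

section Witness

omit [W.IsElliptic] [NeZero N] in
/-- **`res_{U_n → U_{n+1}}` keeps `A`-witnesses**: if `f(τ) = τQ − Q` on points for `τ ∈ N = Gal(ℚ̄_v/ℚ_{v,∞})`, the same holds
for a representative of `res f`. [cite: BDKim2007, Prop. 3.15 (proof)] [cite: NeukirchSchmidtWingberg2008, I §5] -/
theorem exists_resLe_cocycle_of_layerWitness (n : ℕ) (f : contOneCocycles (subgroupRep (torsionLocalRep W N v) (layerGroup κ v n)))
    (Q : localPoints W (v.adicCompletion ℚ))
    (hf : ∀ (τ : absoluteGaloisGroup (v.adicCompletion ℚ)) (hτ : τ ∈ localSubgroup κ.kerSubgroup (v.adicCompletion ℚ)),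
      pointsMap W (v.adicCompletion ℚ) ((f.1 ⟨τ, TwistLayer.localSubgroup_le_layerGroup κ v n hτ⟩ : geomTorsion W N) :
        geomPoints W) = τ • Q - Q) :
    ∃ f' : contOneCocycles (subgroupRep (torsionLocalRep W N v) (layerGroup κ v (n + 1))),
      oneCocycleClass _ f' = resLe (torsionLocalRep W N v) (layerGroup_antitone κ v n) 1 (oneCocycleClass _ f) ∧
      ∀ (τ : absoluteGaloisGroup (v.adicCompletion ℚ)) (hτ : τ ∈ localSubgroup κ.kerSubgroup (v.adicCompletion ℚ)),
        pointsMap W (v.adicCompletion ℚ) ((f'.1 ⟨τ, TwistLayer.localSubgroup_le_layerGroup κ v (n + 1) hτ⟩ : geomTorsion W N) :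
          geomPoints W) = τ • Q - Q := by
  obtain ⟨f', hf', hval⟩ := exists_resLe_cocycle_apply_eq_generic W (N : ℤ) (layerGroup_antitone κ v n) f
  exact ⟨f', hf', fun τ hτ ↦ by rw [hval]; exact hf τ hτ⟩

omit [W.IsElliptic] [NeZero N] in
/-- **(D5, witness) `cor_{U_{n+1} → U_n}` carries `A`-witnesses to their norms**: for a `U_{n+1}`-cocycle `f` of `E[N]|` with
`f(τ) = τQ − Q` on points for `τ ∈ N = Gal(ℚ̄_v/ℚ_{v,∞})` and a system `s` of representatives of `U_n ⧸ U_{n+1}`, a representative `F` of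
`cor_{U_{n+1}→U_n}[f]` satisfies `F(τ) = τQ' − Q'` on points for `τ ∈ N`, `Q' = Σ_x s(x) • Q` (Kim: «`Cor^m_n`» on points is the norm).
[cite: BDKim2007, Prop. 3.15 (proof)] [cite: NeukirchSchmidtWingberg2008, I §5 (1.5.6)–(1.5.7)] -/
theorem exists_coresLe_cocycle_of_layerWitness (n : ℕ)
    [Fintype (layerGroup κ v n ⧸ (layerGroup κ v (n + 1)).subgroupOf (layerGroup κ v n))]
    {s : layerGroup κ v n ⧸ (layerGroup κ v (n + 1)).subgroupOf (layerGroup κ v n) → layerGroup κ v n}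
    (hs : ∀ x, (s x : layerGroup κ v n ⧸ (layerGroup κ v (n + 1)).subgroupOf (layerGroup κ v n)) = x)
    (f : contOneCocycles (subgroupRep (torsionLocalRep W N v) (layerGroup κ v (n + 1))))
    (Q : localPoints W (v.adicCompletion ℚ))
    (hf : ∀ (τ : absoluteGaloisGroup (v.adicCompletion ℚ)) (hτ : τ ∈ localSubgroup κ.kerSubgroup (v.adicCompletion ℚ)),
      pointsMap W (v.adicCompletion ℚ) ((f.1 ⟨τ, TwistLayer.localSubgroup_le_layerGroup κ v (n + 1) hτ⟩ : geomTorsion W N) :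
        geomPoints W) = τ • Q - Q) :
    ∃ F : contOneCocycles (subgroupRep (torsionLocalRep W N v) (layerGroup κ v n)),
      oneCocycleClass _ F =
        coresLe (torsionLocalRep W N v) (layerGroup_antitone κ v n) (isOpen_layerGroup κ v (n + 1)) (oneCocycleClass _ f) ∧
      ∀ (τ : absoluteGaloisGroup (v.adicCompletion ℚ)) (hτ : τ ∈ localSubgroup κ.kerSubgroup (v.adicCompletion ℚ)),
        pointsMap W (v.adicCompletion ℚ) ((F.1 ⟨τ, TwistLayer.localSubgroup_le_layerGroup κ v n hτ⟩ : geomTorsion W N) :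
          geomPoints W) =
          τ • (∑ x, ((s x : absoluteGaloisGroup (v.adicCompletion ℚ)) • Q)) -
            ∑ x, ((s x : absoluteGaloisGroup (v.adicCompletion ℚ)) • Q) := by
  haveI := normal_layerGroup κ v (n + 1)
  haveI : (localSubgroup κ.kerSubgroup (v.adicCompletion ℚ)).Normal := by
    rw [localSubgroup_eq_comap]; infer_instance
  exact exists_coresLe_cocycle_of_witness_generic W (N : ℤ) (layerGroup_antitone κ v n) (isOpen_layerGroup κ v (n + 1)) hs
    (localSubgroup κ.kerSubgroup (v.adicCompletion ℚ)) (TwistLayer.localSubgroup_le_layerGroup κ v (n + 1)) f Q hf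

omit [W.IsElliptic] [NeZero N] in
/-- **(D6, witness) the conjugation action carries `A`-witnesses to their translates**: for `g ∈ Γ_{ℚ_v}` and a `U_n`-cocycle `f` of
`E[N]|` with `f(τ) = τQ − Q` on points for `τ ∈ N`, a representative of `g·[f]` (`layerConj`) satisfies the same with `g • Q`
(and `A = ⋃ₙ E⁺(ℚ_{v,n})` is `Γ_{ℚ_v}`-stable, `PlusDualTwo.smul_mem_iSup_signedLocalPoints`). [cite: SerreLocalFields1979, VII §5]
[cite: Kobayashi2003, (8.23) (p. 18)] -/
theorem exists_layerConj_cocycle_of_layerWitness (n : ℕ) (g : absoluteGaloisGroup (v.adicCompletion ℚ))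
    (f : contOneCocycles (subgroupRep (torsionLocalRep W N v) (layerGroup κ v n)))
    (Q : localPoints W (v.adicCompletion ℚ))
    (hf : ∀ (τ : absoluteGaloisGroup (v.adicCompletion ℚ)) (hτ : τ ∈ localSubgroup κ.kerSubgroup (v.adicCompletion ℚ)),
      pointsMap W (v.adicCompletion ℚ) ((f.1 ⟨τ, TwistLayer.localSubgroup_le_layerGroup κ v n hτ⟩ : geomTorsion W N) :
        geomPoints W) = τ • Q - Q) :
    ∃ F : contOneCocycles (subgroupRep (torsionLocalRep W N v) (layerGroup κ v n)),
      oneCocycleClass _ F = layerConj W N κ v n g (oneCocycleClass _ f) ∧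
      ∀ (τ : absoluteGaloisGroup (v.adicCompletion ℚ)) (hτ : τ ∈ localSubgroup κ.kerSubgroup (v.adicCompletion ℚ)),
        pointsMap W (v.adicCompletion ℚ) ((F.1 ⟨τ, TwistLayer.localSubgroup_le_layerGroup κ v n hτ⟩ : geomTorsion W N) :
          geomPoints W) = τ • (g • Q) - g • Q := by
  haveI := normal_layerGroup κ v n
  haveI : (localSubgroup κ.kerSubgroup (v.adicCompletion ℚ)).Normal := by
    rw [localSubgroup_eq_comap]; infer_instance
  exact exists_conj_cocycle_of_witness_generic W (N : ℤ) (layerGroup κ v n) g (localSubgroup κ.kerSubgroup (v.adicCompletion ℚ))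
    (TwistLayer.localSubgroup_le_layerGroup κ v n) f Q hf

/-- **The layer Kummer class of a point is represented by the Kummer cocycle of any root**: for `P ∈ E(ℚ_{n,v})` and `Q` with
`N • Q = P`, `κ_{U_n}(P) = [τ ↦ τQ − Q]`. [cite: SilvermanAEC2009, VIII §2] [cite: Kobayashi2003, §2 (p. 4)] -/
theorem layerKummer_eq_oneCocycleClass_of_root (n : ℕ)
    (P : localLayerPointsOfEmb κ (closureEmb (K := ℚ) (v.adicCompletion ℚ)) W n) (Q : localPoints W (v.adicCompletion ℚ))
    (hQ : (N : ℤ) • Q = (P : localPoints W (v.adicCompletion ℚ))) :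
    ∃ hQfix : (N : ℤ) • Q ∈ FixedPoints.addSubgroup (layerGroup κ v n) (localPoints W (v.adicCompletion ℚ)),
      layerKummer W N κ v n P =
        oneCocycleClass _ (W.subgroupKummerCocycle (N : ℤ) (layerGroup κ v n) (by exact_mod_cast (NeZero.ne N)) Q hQfix) := by
  have hQfix : (N : ℤ) • Q ∈ FixedPoints.addSubgroup (layerGroup κ v n) (localPoints W (v.adicCompletion ℚ)) := by
    rw [hQ]; exact P.2
  exact ⟨hQfix, W.subgroupKummerMap_apply_eq (N : ℤ) (layerGroup κ v n) _ P Q hQfix hQ⟩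

/-- **(D7) Layer Kummer classes have `A`-witnesses**: for `P ∈ E(ℚ_{n,v})` there are a representative `f` of `κ_{U_n}(P)` and a
root `Q`, `N • Q = P`, with `f(τ) = τQ − Q` on points for all `τ ∈ N = Gal(ℚ̄_v/ℚ_{v,∞})` (indeed for all `τ ∈ U_n`). So the honest
layer Kummer classes of ISO-1c (`LayerKummerIso.cupProduct_layerShapiro_layerKummer_eq_zero`) are witness classes with point `P`.
[cite: SilvermanAEC2009, VIII §2] [cite: BDKim2007, Prop. 3.15 (proof)] -/
theorem exists_layerKummer_cocycle_witness (n : ℕ)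
    (P : localLayerPointsOfEmb κ (closureEmb (K := ℚ) (v.adicCompletion ℚ)) W n) :
    ∃ (f : contOneCocycles (subgroupRep (torsionLocalRep W N v) (layerGroup κ v n))) (Q : localPoints W (v.adicCompletion ℚ)),
      oneCocycleClass _ f = layerKummer W N κ v n P ∧ (N : ℤ) • Q = (P : localPoints W (v.adicCompletion ℚ)) ∧
      ∀ (τ : absoluteGaloisGroup (v.adicCompletion ℚ)) (hτ : τ ∈ localSubgroup κ.kerSubgroup (v.adicCompletion ℚ)),
        pointsMap W (v.adicCompletion ℚ) ((f.1 ⟨τ, TwistLayer.localSubgroup_le_layerGroup κ v n hτ⟩ : geomTorsion W N) :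
          geomPoints W) = τ • Q - Q := by
  have hN : (N : ℤ) ≠ 0 := by exact_mod_cast (NeZero.ne N)
  have hQ : (N : ℤ) • W.subgroupZSMulRoot (N : ℤ) hN (P : localPoints W (v.adicCompletion ℚ)) =
      (P : localPoints W (v.adicCompletion ℚ)) := W.zsmul_subgroupZSMulRoot (N : ℤ) hN _
  obtain ⟨hQfix, hcl⟩ := layerKummer_eq_oneCocycleClass_of_root W N κ v n P _ hQ
  exact ⟨_, _, hcl.symm, hQ, fun τ hτ ↦ W.pointsMap_subgroupKummerCocycle_apply (N : ℤ) (layerGroup κ v n) hN _ hQfix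
    ⟨τ, TwistLayer.localSubgroup_le_layerGroup κ v n hτ⟩⟩

end Witness

end Summit.BirchSwinnertonDyer.BirchSwinnertonDyer.Theorems.SignedEC.LayerClassPairing

end
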